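import Literature.NumberTheory.Automorphic.UnitaryGroupGaloisConjRankTwo
import Literature.NumberTheory.GelbartRogawski1991.LocalGaloisConjCentreDet
import Literature.NumberTheory.Automorphic.UnitaryGroupLocalCongr
import HarnessLib

/-!
# Rank two: `g ↦ ḡ` on `U(T)(F_v)` IS a central determinant twist of the rational similitude `Ad((wT)⁻¹)`

Topic `NumberTheory/GelbartRogawski1991`; namespace `Literature.NumberTheory.Automorphic.UnitaryGroup` (home of ★ `localPiGalConj`, `localCongr`, `localCenter`,
`localUnitScalar`).  KERNEL ONLY: theorems; no definition, no named fact, no `sorry`.  Cell `hodgecm-mathlib` (D-0151), programme P5 (crux HLiu418 =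
stmt-HodgeConjecture-24832), piece **(C2) = (M2) group level** of the road card `F0/P5/A-p18/g23/ROAD-L4if-v3.A-p18g23.md` §6 (A-p18 (g23), 2026-08-31).

THE MATHEMATICS ([MoeglinVignerasWaldspurger1987, Chap. 1 I.17]: similitudes of hermitian spaces; the `2 × 2` identity `ᵗg⁻¹ = (det g)⁻¹ w g w⁻¹`).  For a
symmetric invertible `T ∈ GL₂(F)`, `J = T ⊗ 1`, `w = (0 1; −1 0)`, `k₀ := (wT)⁻¹ ∈ GL₂(F)` is an `F`-RATIONAL SIMILITUDE of `T` with multiplier `(det T)⁻¹`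
(`transpose_inv_w_mul_mul_mul_inv_w_mul`, from ★ L1 `transpose_w_mul_form_mul_self`), so that `Ad(k) : u ↦ k u k⁻¹`, `k = k₀ ⊗ 1`, is the tree's local congruence
★ `localCongr E c k (det J ≠ 0) h v` (`formCongr_inv_w_mul`); and ★ L1 `det_smul_w_mul_localForm_mul_conj_eq` («`det g • (wJ)ḡ = g(wJ)`») becomes, for every
`u ∈ U(J)(F_v)` (factor form ★ `localPi`):
  **`ū = ((det u)⁻¹ · 1₂) · (k u k⁻¹)`**,  `(det u)⁻¹ · 1₂ = localCenter (localUnitScalar (det u)⁻¹)` (`localPiGalConj_eq_localCenter_mul_localCongr`) —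
the Galois conjugation of `U(T)(F_v)` is the rational-similitude automorphism `Ad(k)` followed by the CENTRAL element `(det u)⁻¹`.  With ★ P3u / ★ L4-Ad / ★ L4
this is step (M2) of the road: for a representation `π` on which the centre acts by `χ`, `π(ū) = χ((det u)⁻¹) π(k u k⁻¹)`.
Nothing of the cited sources is asserted; HC_CM is proved only modulo the printed citations until rung 0 closes.

## References
* [MoeglinVignerasWaldspurger1987] LNM 1291 (1987), Chap. 1 I.17.
* [PlatonovRapinchuk1994] V. Platonov, A. Rapinchuk, Algebraic Groups and Number Theory (1994), §2.3 (congruent forms, conjugate unitary groups).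
* [Mok2014] C. P. Mok, Mem. AMS 235 (2015), §1 Notation p. 5 (the centre of `U(N)`).
-/

set_option autoImplicit false

noncomputable section

open scoped Matrix
open NumberField IsDedekindDomain Matrix

namespace Literature.NumberTheory.Automorphic.UnitaryGroup

/-! ## §1 The rational similitude `k₀ = (wT)⁻¹` -/

section Rational

variable {F : Type} [Field F] {E : Type} [Field E] [Algebra F E] (c : E ≃ₐ[F] E)
  {T : Matrix (Fin 2) (Fin 2) F} (hT : T.IsSymm) {J : Matrix (Fin 2) (Fin 2) E} (hJ : J = T.map (algebraMap F E))

/-- `det (wT) ≠ 0`. [cite: MoeglinVignerasWaldspurger1987, Chap. 1 I.17] -/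
theorem det_w_mul_ne_zero (hTd : T.det ≠ 0) : (!![(0 : F), 1; -1, 0] * T).det ≠ 0 := by
  rw [det_w_mul_form]; exact hTd

include hT in
/-- **`k₀ = (wT)⁻¹` is a similitude of `T` with multiplier `(det T)⁻¹`**: `ᵗk₀ T k₀ = (det T)⁻¹ • T`. [cite: MoeglinVignerasWaldspurger1987, Chap. 1 I.17] -/
theorem transpose_inv_w_mul_mul_mul_inv_w_mul (hTd : T.det ≠ 0) :
    (((Matrix.GeneralLinearGroup.mkOfDetNeZero _ (det_w_mul_ne_zero hTd))⁻¹ : GL (Fin 2) F) : Matrix (Fin 2) (Fin 2) F)ᵀ * T *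
        (((Matrix.GeneralLinearGroup.mkOfDetNeZero _ (det_w_mul_ne_zero hTd))⁻¹ : GL (Fin 2) F) : Matrix (Fin 2) (Fin 2) F) = T.det⁻¹ • T := by
  have h1 : ((Matrix.GeneralLinearGroup.mkOfDetNeZero _ (det_w_mul_ne_zero hTd) : GL (Fin 2) F) : Matrix (Fin 2) (Fin 2) F)ᵀ * T *
      ((Matrix.GeneralLinearGroup.mkOfDetNeZero _ (det_w_mul_ne_zero hTd) : GL (Fin 2) F) : Matrix (Fin 2) (Fin 2) F) = T.det • T :=
    transpose_w_mul_form_mul_self hT.eq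
  have h2 : T.det • ((((Matrix.GeneralLinearGroup.mkOfDetNeZero _ (det_w_mul_ne_zero hTd))⁻¹ : GL (Fin 2) F) : Matrix (Fin 2) (Fin 2) F)ᵀ * T *
      (((Matrix.GeneralLinearGroup.mkOfDetNeZero _ (det_w_mul_ne_zero hTd))⁻¹ : GL (Fin 2) F) : Matrix (Fin 2) (Fin 2) F)) = T := by
    rw [← Matrix.smul_mul, ← Matrix.mul_smul, ← h1]
    simp only [← Matrix.mul_assoc]
    rw [← Matrix.transpose_mul, ← Units.val_mul, mul_inv_cancel, Units.val_one, Matrix.transpose_one, Matrix.one_mul, Matrix.mul_assoc, ← Units.val_mul,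
      mul_inv_cancel, Units.val_one, Matrix.mul_one]
  calc _ = T.det⁻¹ • (T.det • ((((Matrix.GeneralLinearGroup.mkOfDetNeZero _ (det_w_mul_ne_zero hTd))⁻¹ : GL (Fin 2) F) : Matrix (Fin 2) (Fin 2) F)ᵀ * T *
      (((Matrix.GeneralLinearGroup.mkOfDetNeZero _ (det_w_mul_ne_zero hTd))⁻¹ : GL (Fin 2) F) : Matrix (Fin 2) (Fin 2) F))) := by
        rw [smul_smul, inv_mul_cancel₀ hTd, one_smul]
    _ = T.det⁻¹ • T := by rw [h2]

include hJ in
/-- `det J = det T` read in `E`. [cite: MoeglinVignerasWaldspurger1987, Chap. 1 I.17] -/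
theorem det_form_eq : J.det = algebraMap F E T.det := by
  rw [hJ, ← RingHom.mapMatrix_apply, ← RingHom.map_det]

include hT hJ in
/-- **the similitude identity for ★ `localCongr`**: `ᵗ(c k) · (det J • J) · k = J` for `k = k₀ ⊗ 1 = (wJ)⁻¹` (`F`-rational, hence `c`-fixed).
[cite: PlatonovRapinchuk1994, §2.3] [cite: MoeglinVignerasWaldspurger1987, Chap. 1 I.17] -/
theorem formCongr_inv_w_mul (hTd : T.det ≠ 0) :
    formCongr (c : E →+* E) (Matrix.GeneralLinearGroup.map (algebraMap F E) (Matrix.GeneralLinearGroup.mkOfDetNeZero _ (det_w_mul_ne_zero hTd))⁻¹)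
      (J.det • J) = J := by
  rw [det_form_eq hJ]
  subst hJ
  have hcoe : (((Matrix.GeneralLinearGroup.map (algebraMap F E) (Matrix.GeneralLinearGroup.mkOfDetNeZero _ (det_w_mul_ne_zero hTd))⁻¹ : GL (Fin 2) E)) :
      Matrix (Fin 2) (Fin 2) E) =
      (((Matrix.GeneralLinearGroup.mkOfDetNeZero _ (det_w_mul_ne_zero hTd))⁻¹ : GL (Fin 2) F) : Matrix (Fin 2) (Fin 2) F).map (algebraMap F E) := rfl
  rw [formCongr, hcoe, Matrix.map_map]
  have hc : ((c : E → E)) ∘ (algebraMap F E) = algebraMap F E := funext fun x => c.commutes x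
  rw [show ((c : E →+* E) : E → E) ∘ (algebraMap F E) = algebraMap F E from hc, ← Matrix.map_smul' _ _ _ (map_mul (algebraMap F E)),
    ← Matrix.transpose_map, ← Matrix.map_mul, ← Matrix.map_mul, Matrix.mul_smul, Matrix.smul_mul, transpose_inv_w_mul_mul_mul_inv_w_mul hT hTd,
    smul_smul, mul_inv_cancel₀ hTd, one_smul]

end Rational

/-! ## §2 `ū = (det u)⁻¹ · Ad(k)(u)` on `U(T)(F_v)` -/

section Local

variable {F : Type} (E : Type) [Field F] [NumberField F] [Field E] [NumberField E] [Algebra F E]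
  (c : E ≃ₐ[F] E) {T : Matrix (Fin 2) (Fin 2) F} (hT : T.IsSymm) {J : Matrix (Fin 2) (Fin 2) E} (hJ : J = T.map (algebraMap F E))
  {J₁ : Matrix (Fin 1) (Fin 1) E} (hJ₁ : J₁ 0 0 ≠ 0) (v : HeightOneSpectrum (𝓞 F)) {δ : E} (hcδ : c δ = -δ) (hδ : δ ≠ 0)

/-- `localPiEquiv (B u B⁻¹) = B_v · localPiEquiv u · B_v⁻¹` (unfolding ★ `localCongr`). [cite: PlatonovRapinchuk1994, §2.3] -/
private theorem coe_localPiEquiv_localCongr' {N : ℕ} {J J' : Matrix (Fin N) (Fin N) E} (B : GL (Fin N) E) {b : E} (hb : b ≠ 0)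
    (h : formCongr (c : E →+* E) B (b • J) = J') (u : localPi E c N J' v) :
    ((localPiEquiv E c N J v (localCongr E c B hb h v u) : «local» E c N J v) : GL (Fin N) (LocalRing E v)) =
      toLocalGL E v B * ((localPiEquiv E c N J' v u : «local» E c N J' v) : GL (Fin N) (LocalRing E v)) * (toLocalGL E v B)⁻¹ := by
  rw [localCongr, ContinuousMulEquiv.trans_apply, ContinuousMulEquiv.trans_apply, ContinuousMulEquiv.apply_symm_apply,
    ContinuousMulEquiv.coe_restrictSubgroup_apply, GLn.conjEquiv_apply]

omit [NumberField F] [NumberField E] in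
include hJ in
/-- `det J ≠ 0` in `E`. [cite: MoeglinVignerasWaldspurger1987, Chap. 1 I.17] -/
theorem det_form_ne_zero (hTd : T.det ≠ 0) : J.det ≠ 0 := by
  rw [det_form_eq hJ]; exact (map_ne_zero _).2 hTd

include hJ in
/-- **`det u` is a norm-one scalar of `E ⊗ F_v`** for `u ∈ U(T)(F_v)`: `det u · c(det u) = 1`. [cite: Mok2014, §1 Notation p. 5] -/
theorem det_mul_conjLocal_det (hTd : T.det ≠ 0) (u : localPi E c 2 J v) :
    ((Matrix.GeneralLinearGroup.det (localPiEquiv E c 2 J v u).1 : (LocalRing E v)ˣ) : LocalRing E v) *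
        conjLocal E c v ((Matrix.GeneralLinearGroup.det (localPiEquiv E c 2 J v u).1 : (LocalRing E v)ˣ) : LocalRing E v) = 1 := by
  have h := det_localGalConj_mul_det E c 2 v (isUnit_iff_ne_zero.2 hTd) hJ (localPiEquiv E c 2 J v u)
  rw [val_det_localGalConj, mul_comm] at h
  exact h

include hJ hcδ hδ in
/-- hence `(det u)⁻¹ · c((det u)⁻¹) = 1` (★ `norm_one_inv`). [cite: Mok2014, §1 Notation p. 5] -/
theorem inv_det_mul_conjLocal_inv_det [Algebra.IsQuadraticExtension F E] (hTd : T.det ≠ 0) (u : localPi E c 2 J v) :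
    (((Matrix.GeneralLinearGroup.det (localPiEquiv E c 2 J v u).1)⁻¹ : (LocalRing E v)ˣ) : LocalRing E v) *
        conjLocal E c v (((Matrix.GeneralLinearGroup.det (localPiEquiv E c 2 J v u).1)⁻¹ : (LocalRing E v)ˣ) : LocalRing E v) = 1 :=
  norm_one_inv E c v hcδ hδ _ (det_mul_conjLocal_det E c hJ v hTd u)

include hT hcδ hδ in
/-- **`ū = (det u)⁻¹ · (k u k⁻¹)` on `U(T)(F_v)`** (rank 2, factor form): the Galois conjugation ★ `localPiGalConj` IS the local congruence ★ `localCongr` of the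
rational similitude `k = (wJ)⁻¹` followed by the central element `localCenter (localUnitScalar (det u)⁻¹)`.
[cite: MoeglinVignerasWaldspurger1987, Chap. 1 I.17] [cite: PlatonovRapinchuk1994, §2.3] [cite: Mok2014, §1 Notation p. 5] -/
theorem localPiGalConj_eq_localCenter_mul_localCongr [Algebra.IsQuadraticExtension F E] (hTd : T.det ≠ 0) (u : localPi E c 2 J v) :
    localPiGalConj E c 2 v hJ u =
      localCenter E c 2 J J₁ hJ₁ v (localUnitScalar E c J₁ v _ (inv_det_mul_conjLocal_inv_det E c hJ v hcδ hδ hTd u)) *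
        localCongr E c (Matrix.GeneralLinearGroup.map (algebraMap F E) (Matrix.GeneralLinearGroup.mkOfDetNeZero _ (det_w_mul_ne_zero hTd))⁻¹)
          (det_form_ne_zero E hJ hTd) (formCongr_inv_w_mul c hT hJ hTd) v u := by
  apply (localPiEquiv E c 2 J v).injective
  rw [localPiEquiv_localPiGalConj, map_mul]
  refine Subtype.ext (Units.ext ?_)
  rw [val_localGalConj, Subgroup.coe_mul, Units.val_mul, coe_localPiEquiv_localCenter_localUnitScalar, coe_localPiEquiv_localCongr', Units.val_mul,
    Units.val_mul, Matrix.smul_mul, Matrix.one_mul]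
  -- the matrices of `k_v⁻¹ = wJ_v` and `k_v`
  have hkinv : ((toLocalGL E v (Matrix.GeneralLinearGroup.map (algebraMap F E) (Matrix.GeneralLinearGroup.mkOfDetNeZero _ (det_w_mul_ne_zero hTd))⁻¹))⁻¹).1 =
      !![(0 : LocalRing E v), 1; -1, 0] * (adelicForm E 2 J).map (adeleToLocal E v) := by
    rw [map_inv, map_inv, inv_inv, coe_toLocalGL_apply]
    change ((!![(0 : F), 1; -1, 0] * T).map (algebraMap F E)).map (algebraMap E (LocalRing E v)) = _
    rw [adelicForm_map_adeleToLocal, hJ, Matrix.map_mul, Matrix.map_mul, Matrix.map_map]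
    congr 1
    ext i j
    fin_cases i <;> fin_cases j <;> simp
  have hk : (toLocalGL E v (Matrix.GeneralLinearGroup.map (algebraMap F E) (Matrix.GeneralLinearGroup.mkOfDetNeZero _ (det_w_mul_ne_zero hTd))⁻¹)).1 =
      (!![(0 : LocalRing E v), 1; -1, 0] * (adelicForm E 2 J).map (adeleToLocal E v))⁻¹ := by
    rw [← hkinv, Matrix.coe_units_inv]
    exact (Matrix.nonsing_inv_nonsing_inv _ (Matrix.isUnits_det_units _)).symm
  have hwJ : IsUnit (!![(0 : LocalRing E v), 1; -1, 0] * (adelicForm E 2 J).map (adeleToLocal E v)).det := by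
    rw [← hkinv]; exact Matrix.isUnits_det_units _
  rw [hk, hkinv]
  -- ★ L1: `det u • (wJ ū) = u (wJ)`, i.e. `ū = (det u)⁻¹ • ((wJ)⁻¹ u (wJ))` (with the unit `det u`)
  have hL1 := det_smul_w_mul_localForm_mul_conj_eq E c v hT hJ (localPiEquiv E c 2 J v u)
  have hd : ((localPiEquiv E c 2 J v u).1.1).det = ((Matrix.GeneralLinearGroup.det (localPiEquiv E c 2 J v u).1 : (LocalRing E v)ˣ) : LocalRing E v) := rfl
  rw [hd] at hL1
  have h2 : !![(0 : LocalRing E v), 1; -1, 0] * (adelicForm E 2 J).map (adeleToLocal E v) * (localPiEquiv E c 2 J v u).1.1.map (conjLocal E c v) =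
      (((Matrix.GeneralLinearGroup.det (localPiEquiv E c 2 J v u).1)⁻¹ : (LocalRing E v)ˣ) : LocalRing E v) •
        ((localPiEquiv E c 2 J v u).1.1 * (!![(0 : LocalRing E v), 1; -1, 0] * (adelicForm E 2 J).map (adeleToLocal E v))) := by
    rw [← hL1, smul_smul, Units.inv_mul, one_smul]
  have h3 : (localPiEquiv E c 2 J v u).1.1.map (conjLocal E c v) =
      (((Matrix.GeneralLinearGroup.det (localPiEquiv E c 2 J v u).1)⁻¹ : (LocalRing E v)ˣ) : LocalRing E v) •
        ((!![(0 : LocalRing E v), 1; -1, 0] * (adelicForm E 2 J).map (adeleToLocal E v))⁻¹ *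
          ((localPiEquiv E c 2 J v u).1.1 * (!![(0 : LocalRing E v), 1; -1, 0] * (adelicForm E 2 J).map (adeleToLocal E v)))) := by
    rw [← Matrix.mul_smul, ← h2, ← Matrix.mul_assoc, Matrix.nonsing_inv_mul _ hwJ, Matrix.one_mul]
  rw [h3, Matrix.mul_assoc]

end Local

end Literature.NumberTheory.Automorphic.UnitaryGroup

end
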